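import Mathlib
import Literature.MathematicalPhysics.StatisticalMechanics.LennardJonesClusters
import HarnessLib

/-!
# `GappedShellCensus.RadialDefectsVanish` (stmt-AtomisticToContinuum-15930) — the SPLIT glue (STANDALONE form)

This module deliberately does NOT import the route file (glue.cyclic-import rule of `route edit --glue-by`):
the conclusion of `RadialDefectsVanish_of_subs` is the crux's statement written out LITERALLY (definitionally
the route decl `Summit.AtomisticToContinuum.Crystallization.Theses.GappedShellCensus.RadialDefectsVanish`,
ledger signature of stmt-AtomisticToContinuum-15930), so that after a prover lands this file verbatim as
`Theorems/GappedShellCensusRadialDefectsVanishSplit.lean` the split can be filed with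
`ledger route edit route-AtomisticToContinuum-GappedShellCensus --split RadialDefectsVanish --into children.json --glue-by
Summit.AtomisticToContinuum.Crystallization.Theorems.RadialDefectsVanish_of_subs`.

Strategist decomposition (crux-strategist, 2026-08-17) of the radial crux into three pieces, and the
kernel-checked implication `RadialDefectsVanish_of_subs : TwelveWithinOne → ThickThirteen →
GapBeyondTwelve → RadialDefectsVanish` (hypotheses stated LITERALLY — they are the children of the
split; no new definitions are introduced in this file):

* `TwelveWithinOne` — VERBATIM the one-sided radial crux of route `SquareWellLayerCake`
  (stmt-AtomisticToContinuum-15808): along every sequence of Lennard-Jones ground states the fraction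
  of sites failing [every particle within `11/10` is `55/57`-separated from all others ∧ at least
  twelve particles within distance `1`] tends to `0` (ENERGY, one-sided: only under-coordination and
  compression are charged).
* `ThickThirteen` — at most twelve points of `ℝ³` with norms in `[55/57, 1]` and mutual distances
  `≥ 55/57` (GEOMETRY, theorem-grade: radial projection gives unit vectors at chord `≥ 55/57 = 0.9649 >
  0.957 > 2 sin(δ₁₃/2) = 0.9565`, so it is the strong thirteen-spheres theorem of Musin–Tarasov 2012 in
  thick-shell form, cf. `Literature.Geometry.DiscreteGeometry.musinTarasov2012_tammes_thirteen`).
* `GapBeyondTwelve` — along every sequence of ground states, for every `θ > 0`, frequently in `N`, at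
  most `θN` sites `i` are LOCALLY TWELVE (every site within `7/2` of `x_i`, `x_i` included, has a
  `55/57`-separated `11/10`-neighbourhood and exactly twelve others within `1`) and yet have another site
  at distance in the open annulus `(1, 21/17)` (the Hales-gap clause; NOT one-centre geometry at this
  tolerance — twelve points of the shell `[55/57, 1]`, pairwise `≥ 55/57`, leave room for a 13th point at
  every radius `≥ 1.12` — so it is a k-centre geometric or an energetic statement about minimisers).

Glue: `ThickThirteen` upgrades "≥ 12 within 1" to "exactly 12 within 1" pointwise
(`card_bond_le_twelve`); a locally-twelve site with no annulus neighbour is gapped-twelve at the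
SELECTED scale `a = 50/51` (`gappedTwelve_of_twelve`: bond window `[49/51, 1] ⊇ [55/57, 1]`, gap
`(1, 21/17) = (1.02a, 1.26a)`); sites that are not locally twelve lie within `7/2` of a non-twelve site,
at most `(7/δ₀ + 1)³` of them per non-twelve site by the `δ₀`-separation of ground states
(`LennardJonesMinimalDistance_holds`) and the packing count `card_le_of_separated_of_dist_le`
(`card_le_mul_card_of_local`); `Tendsto`/`Frequently` bookkeeping finishes.  The ground-state hypothesis
is spent inside the two energetic children and on `δ₀` (cf. `radialDefectsVanish_false_without_GS`).
-/

noncomputable section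

open scoped BigOperators Topology Classical
open Filter Finset
open Literature.MathematicalPhysics.StatisticalMechanics

namespace Summit.AtomisticToContinuum.Crystallization.Theorems

namespace RdvSplit

local notation "E3" => EuclideanSpace ℝ (Fin 3)

variable {N : ℕ}

/-- **Thick thirteen ⇒ at most twelve bonds.**  If every site within `11/10` of `X i` is
`55/57`-separated from all other sites and no thirteen points of `ℝ³` with norms in `[55/57, 1]` are
pairwise `≥ 55/57` apart, then at most twelve other sites lie within distance `1` of `X i` (translate the
bond set to the origin). [folklore] -/
theorem card_bond_le_twelve
    (hT : ∀ T : Finset (EuclideanSpace ℝ (Fin 3)), (∀ v ∈ T, (55 : ℝ) / 57 ≤ ‖v‖ ∧ ‖v‖ ≤ 1) →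
      (∀ v ∈ T, ∀ w ∈ T, v ≠ w → (55 : ℝ) / 57 ≤ dist v w) → T.card ≤ 12)
    (X : Fin N → E3) {i : Fin N}
    (hNb : ∀ j : Fin N, dist (X i) (X j) ≤ 11 / 10 → ∀ k : Fin N, k ≠ j → (55 : ℝ) / 57 ≤ dist (X j) (X k)) :
    (Finset.univ.filter fun j : Fin N => j ≠ i ∧ dist (X i) (X j) ≤ 1).card ≤ 12 := by
  set S := Finset.univ.filter fun j : Fin N => j ≠ i ∧ dist (X i) (X j) ≤ 1 with hS
  have hSepi : ∀ k : Fin N, k ≠ i → (55 : ℝ) / 57 ≤ dist (X i) (X k) :=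
    hNb i (by rw [dist_self]; norm_num)
  have hmemS : ∀ j ∈ S, j ≠ i ∧ dist (X i) (X j) ≤ 1 := fun j hj => (Finset.mem_filter.1 hj).2
  have hSepS : ∀ j ∈ S, ∀ k : Fin N, k ≠ j → (55 : ℝ) / 57 ≤ dist (X j) (X k) := fun j hj =>
    hNb j ((hmemS j hj).2.trans (by norm_num))
  have hinj : Set.InjOn (fun j => X j - X i) (S : Set (Fin N)) := by
    intro j hj j' hj' hjj'
    by_contra hne
    have h1 : (55 : ℝ) / 57 ≤ dist (X j) (X j') := hSepS j hj j' (Ne.symm hne)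
    have h2 : X j = X j' := sub_left_inj.1 hjj'
    rw [h2, dist_self] at h1
    norm_num at h1
  have hcard : (S.image fun j => X j - X i).card = S.card := Finset.card_image_of_injOn hinj
  have h12 : (S.image fun j => X j - X i).card ≤ 12 := by
    refine hT _ ?_ ?_
    · intro v hv
      obtain ⟨j, hj, rfl⟩ := Finset.mem_image.1 hv
      have hji := hmemS j hj
      have hd : ‖X j - X i‖ = dist (X i) (X j) := by rw [dist_comm, dist_eq_norm]
      rw [hd]
      exact ⟨hSepi j hji.1, hji.2⟩
    · intro v hv w hw hvw
      obtain ⟨j, hj, rfl⟩ := Finset.mem_image.1 hv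
      obtain ⟨j', hj', rfl⟩ := Finset.mem_image.1 hw
      have hne : j' ≠ j := by
        rintro rfl
        exact hvw rfl
      rw [dist_sub_right]
      exact hSepS j hj j' hne
  rw [hcard] at h12
  exact h12

/-- **A twelve-site with no annulus neighbour is gapped-twelve at `a = 50/51`**: its bond set within
`50/51·(1 + 1/50) = 1` has exactly twelve members, every other site is `≥ 55/57 ≥ 49/51 = 50/51·(1 − 1/50)`
away (own separation), and another site beyond `1` is beyond `21/17 = 50/51·(63/50)`. [folklore] -/
theorem gappedTwelve_of_twelve (X : Fin N → E3) {i : Fin N}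
    (hNb : ∀ j : Fin N, dist (X i) (X j) ≤ 11 / 10 → ∀ k : Fin N, k ≠ j → (55 : ℝ) / 57 ≤ dist (X j) (X k))
    (hA : (Finset.univ.filter fun j : Fin N => j ≠ i ∧ dist (X i) (X j) ≤ 1).card = 12)
    (hAnn : ¬ ∃ j : Fin N, j ≠ i ∧ 1 < dist (X i) (X j) ∧ dist (X i) (X j) < 21 / 17) :
    (Finset.univ.filter fun j : Fin N => j ≠ i ∧ dist (X i) (X j) ≤ 50 / 51 * (1 + 1 / 50)).card = 12 ∧
      ∀ j : Fin N, j ≠ i → 50 / 51 * (1 - 1 / 50) ≤ dist (X i) (X j) ∧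
        (dist (X i) (X j) ≤ 50 / 51 * (1 + 1 / 50) ∨ 50 / 51 * (63 / 50) ≤ dist (X i) (X j)) := by
  have hSepi : ∀ k : Fin N, k ≠ i → (55 : ℝ) / 57 ≤ dist (X i) (X k) :=
    hNb i (by rw [dist_self]; norm_num)
  have h1 : (50 : ℝ) / 51 * (1 + 1 / 50) = 1 := by norm_num
  have h2 : (50 : ℝ) / 51 * (63 / 50) = 21 / 17 := by norm_num
  refine ⟨?_, fun j hj => ⟨?_, ?_⟩⟩
  · have hEq : (Finset.univ.filter fun j : Fin N => j ≠ i ∧ dist (X i) (X j) ≤ 50 / 51 * (1 + 1 / 50)) =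
        Finset.univ.filter fun j : Fin N => j ≠ i ∧ dist (X i) (X j) ≤ 1 := by
      refine Finset.filter_congr fun j _ => ?_
      rw [h1]
    rw [hEq]
    exact hA
  · have := hSepi j hj
    have h3 : (50 : ℝ) / 51 * (1 - 1 / 50) ≤ 55 / 57 := by norm_num
    linarith
  · by_cases hd : dist (X i) (X j) ≤ 1
    · left
      rw [h1]
      exact hd
    · right
      rw [h2]
      by_contra hlt
      push Not at hd hlt
      exact hAnn ⟨j, hj, hd, hlt⟩

/-- **Packing count of the spoiled sites** (instance-free form).  In a `δ`-separated configuration,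
if every site of `SL` has, within distance `7/2`, a site violating `G`, and `SB` contains every site
violating `G`, then `#SL ≤ (2·(7/2)/δ + 1)³ · #SB`: each bad site spoils at most that many sites
(`card_le_of_separated_of_dist_le`). [folklore] -/
theorem card_le_mul_card_of_local (X : Fin N → E3) (G : Fin N → Prop) {δ : ℝ} (hδ : 0 < δ)
    (hsep : ∀ i j : Fin N, i ≠ j → δ ≤ dist (X i) (X j)) (SL SB : Finset (Fin N))
    (hSL : ∀ i ∈ SL, ¬ ∀ j : Fin N, dist (X i) (X j) ≤ 7 / 2 → G j) (hSB : ∀ j : Fin N, ¬ G j → j ∈ SB) :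
    (SL.card : ℝ) ≤ (2 * (7 / 2) / δ + 1) ^ 3 * SB.card := by
  set ball : Fin N → Finset (Fin N) := fun j =>
    Finset.univ.filter fun i : Fin N => dist (X i) (X j) ≤ 7 / 2 with hball
  have hsub : SL ⊆ SB.biUnion ball := by
    intro i hi
    have h := hSL i hi
    push Not at h
    obtain ⟨j, hj, hg⟩ := h
    refine Finset.mem_biUnion.2 ⟨j, hSB j hg, ?_⟩
    simp only [hball, Finset.mem_filter, Finset.mem_univ, true_and]
    exact hj
  have hinj : Function.Injective X := by
    intro a b hab
    by_contra hne
    have := hsep a b hne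
    rw [hab, dist_self] at this
    linarith
  have hballcard : ∀ j : Fin N, ((ball j).card : ℝ) ≤ (2 * (7 / 2) / δ + 1) ^ 3 := by
    intro j
    have hc : ((ball j).image X).card = (ball j).card := Finset.card_image_of_injective _ hinj
    have h := card_le_of_separated_of_dist_le ((ball j).image X) (X j) hδ
      (by norm_num : (0 : ℝ) ≤ 7 / 2) ?_ ?_
    · rw [hc, finrank_euclideanSpace_fin] at h
      exact h
    · intro c hc'
      obtain ⟨i, hi, rfl⟩ := Finset.mem_image.1 hc'
      simp only [hball, Finset.mem_filter, Finset.mem_univ, true_and] at hi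
      exact hi
    · intro c hc' d hd hcd
      obtain ⟨a, -, rfl⟩ := Finset.mem_image.1 hc'
      obtain ⟨b, -, rfl⟩ := Finset.mem_image.1 hd
      exact hsep a b fun hab => hcd (by rw [hab])
  calc (SL.card : ℝ)
      ≤ ((SB.biUnion ball).card : ℝ) := by exact_mod_cast Finset.card_le_card hsub
    _ ≤ ∑ j ∈ SB, ((ball j).card : ℝ) := by exact_mod_cast Finset.card_biUnion_le
    _ ≤ ∑ j ∈ SB, (2 * (7 / 2) / δ + 1) ^ 3 := Finset.sum_le_sum fun j _ => hballcard j
    _ = (2 * (7 / 2) / δ + 1) ^ 3 * SB.card := by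
        rw [Finset.sum_const, nsmul_eq_mul, mul_comm]

end RdvSplit

open RdvSplit in
/-- **The split glue** (crux-strategist decomposition of stmt-AtomisticToContinuum-15930):
`TwelveWithinOne → ThickThirteen → GapBeyondTwelve → RadialDefectsVanish`, at the selected scale
`a = 50/51`.  The three hypotheses are the children of the split, stated literally (the first is
verbatim `SquareWellLayerCake.TwelveWithinOne`, stmt-AtomisticToContinuum-15808). [folklore] -/
theorem RadialDefectsVanish_of_subs
    (hK2 : ∀ x : (N : ℕ) → (Fin N → EuclideanSpace ℝ (Fin 3)),
      (∀ N, Literature.MathematicalPhysics.StatisticalMechanics.IsGroundState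
        Literature.MathematicalPhysics.StatisticalMechanics.lennardJones (x N)) →
      Filter.Tendsto (fun N : ℕ => (Nat.card {i : Fin N // ¬ ((∀ j : Fin N, dist (x N i) (x N j) ≤ 11 / 10 →
        ∀ k : Fin N, k ≠ j → (55 : ℝ) / 57 ≤ dist (x N j) (x N k)) ∧
        12 ≤ (Finset.univ.filter fun j : Fin N => j ≠ i ∧ dist (x N i) (x N j) ≤ 1).card)} : ℝ) / N)
        Filter.atTop (nhds 0))
    (hT : ∀ T : Finset (EuclideanSpace ℝ (Fin 3)), (∀ v ∈ T, (55 : ℝ) / 57 ≤ ‖v‖ ∧ ‖v‖ ≤ 1) →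
      (∀ v ∈ T, ∀ w ∈ T, v ≠ w → (55 : ℝ) / 57 ≤ dist v w) → T.card ≤ 12)
    (hG : ∀ x : (N : ℕ) → (Fin N → EuclideanSpace ℝ (Fin 3)),
      (∀ N, Literature.MathematicalPhysics.StatisticalMechanics.IsGroundState
        Literature.MathematicalPhysics.StatisticalMechanics.lennardJones (x N)) →
      ∀ θ : ℝ, 0 < θ → ∃ᶠ N in Filter.atTop, (Nat.card {i : Fin N //
        (∀ j : Fin N, dist (x N i) (x N j) ≤ 7 / 2 →
          (∀ k : Fin N, dist (x N j) (x N k) ≤ 11 / 10 → ∀ l : Fin N, l ≠ k → (55 : ℝ) / 57 ≤ dist (x N k) (x N l)) ∧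
          (Finset.univ.filter fun k : Fin N => k ≠ j ∧ dist (x N j) (x N k) ≤ 1).card = 12) ∧
        ∃ j : Fin N, j ≠ i ∧ 1 < dist (x N i) (x N j) ∧ dist (x N i) (x N j) < 21 / 17} : ℝ) ≤ θ * N) :
    (∀ x : (N : ℕ) → (Fin N → EuclideanSpace ℝ (Fin 3)), (∀ N, Literature.MathematicalPhysics.StatisticalMechanics.IsGroundState Literature.MathematicalPhysics.StatisticalMechanics.lennardJones (x N)) → ∃ a : ℝ, 47 / 50 ≤ a ∧ a ≤ 1 ∧ ∀ θ : ℝ, 0 < θ → ∃ᶠ N in Filter.atTop, (Nat.card {i : Fin N // ¬ ((Finset.univ.filter fun j : Fin N => j ≠ i ∧ dist (x N i) (x N j) ≤ a * (1 + 1 / 50)).card = 12 ∧ ∀ j : Fin N, j ≠ i → a * (1 - 1 / 50) ≤ dist (x N i) (x N j) ∧ (dist (x N i) (x N j) ≤ a * (1 + 1 / 50) ∨ a * (63 / 50) ≤ dist (x N i) (x N j)))} : ℝ) ≤ θ * N) := by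
  intro x hx
  refine ⟨50 / 51, by norm_num, by norm_num, fun θ hθ => ?_⟩
  obtain ⟨δ₀, hδ₀, hsep⟩ := LennardJonesMinimalDistance_holds
  set K : ℝ := (2 * (7 / 2) / δ₀ + 1) ^ 3 with hK
  have hK1 : 1 ≤ K := by
    have h0 : (0 : ℝ) ≤ 2 * (7 / 2) / δ₀ := by positivity
    have h1 : (1 : ℝ) ≤ 2 * (7 / 2) / δ₀ + 1 := by linarith
    exact one_le_pow₀ h1
  have hKpos : 0 < K := by linarith
  -- (1) eventually few non-PRE sites (child `TwelveWithinOne`)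
  have h1 : ∀ᶠ N in Filter.atTop,
      ((Finset.univ.filter fun i : Fin N => ¬ ((∀ j : Fin N, dist (x N i) (x N j) ≤ 11 / 10 →
        ∀ k : Fin N, k ≠ j → (55 : ℝ) / 57 ≤ dist (x N j) (x N k)) ∧
        12 ≤ (Finset.univ.filter fun j : Fin N => j ≠ i ∧ dist (x N i) (x N j) ≤ 1).card)).card : ℝ) ≤
        θ / (2 * K) * N := by
    have hpos : (0 : ℝ) < θ / (2 * K) := by positivity
    filter_upwards [(hK2 x hx).eventually (gt_mem_nhds hpos)] with N hN
    rw [Nat.card_eq_fintype_card, Fintype.card_subtype] at hN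
    rcases Nat.eq_zero_or_pos N with hN0 | hNpos
    · subst hN0
      simp
    · have hNr : (0 : ℝ) < N := by exact_mod_cast hNpos
      exact ((div_lt_iff₀ hNr).1 hN).le
  -- (2) frequently few locally-twelve sites with an annulus neighbour (child `GapBeyondTwelve`)
  have h2 : ∃ᶠ N in Filter.atTop,
      ((Finset.univ.filter fun i : Fin N =>
        (∀ j : Fin N, dist (x N i) (x N j) ≤ 7 / 2 →
          (∀ k : Fin N, dist (x N j) (x N k) ≤ 11 / 10 → ∀ l : Fin N, l ≠ k → (55 : ℝ) / 57 ≤ dist (x N k) (x N l)) ∧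
          (Finset.univ.filter fun k : Fin N => k ≠ j ∧ dist (x N j) (x N k) ≤ 1).card = 12) ∧
        ∃ j : Fin N, j ≠ i ∧ 1 < dist (x N i) (x N j) ∧ dist (x N i) (x N j) < 21 / 17).card : ℝ) ≤
        θ / 2 * N := by
    refine (hG x hx (θ / 2) (by positivity)).mono fun N hN => ?_
    rw [Nat.card_eq_fintype_card, Fintype.card_subtype] at hN
    exact hN
  -- (3) combine at a fixed (frequent) `N`
  refine (h2.and_eventually h1).mono ?_
  rintro N ⟨hA, hP⟩
  rw [Nat.card_eq_fintype_card, Fintype.card_subtype]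
  have hsepN : ∀ i j : Fin N, i ≠ j → δ₀ ≤ dist (x N i) (x N j) := hsep N (x N) (hx N)
  -- the finsets of this `N`
  set SGT := Finset.univ.filter fun i : Fin N => ¬ ((Finset.univ.filter fun j : Fin N =>
      j ≠ i ∧ dist (x N i) (x N j) ≤ 50 / 51 * (1 + 1 / 50)).card = 12 ∧
      ∀ j : Fin N, j ≠ i → 50 / 51 * (1 - 1 / 50) ≤ dist (x N i) (x N j) ∧
        (dist (x N i) (x N j) ≤ 50 / 51 * (1 + 1 / 50) ∨ 50 / 51 * (63 / 50) ≤ dist (x N i) (x N j))) with hSGT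
  set SA := Finset.univ.filter fun i : Fin N =>
      (∀ j : Fin N, dist (x N i) (x N j) ≤ 7 / 2 →
        (∀ k : Fin N, dist (x N j) (x N k) ≤ 11 / 10 → ∀ l : Fin N, l ≠ k → (55 : ℝ) / 57 ≤ dist (x N k) (x N l)) ∧
        (Finset.univ.filter fun k : Fin N => k ≠ j ∧ dist (x N j) (x N k) ≤ 1).card = 12) ∧
      ∃ j : Fin N, j ≠ i ∧ 1 < dist (x N i) (x N j) ∧ dist (x N i) (x N j) < 21 / 17 with hSA
  set SP := Finset.univ.filter fun i : Fin N => ¬ ((∀ j : Fin N, dist (x N i) (x N j) ≤ 11 / 10 →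
      ∀ k : Fin N, k ≠ j → (55 : ℝ) / 57 ≤ dist (x N j) (x N k)) ∧
      12 ≤ (Finset.univ.filter fun j : Fin N => j ≠ i ∧ dist (x N i) (x N j) ≤ 1).card) with hSP
  set SL := Finset.univ.filter fun i : Fin N => ¬ ∀ j : Fin N, dist (x N i) (x N j) ≤ 7 / 2 →
      ((∀ k : Fin N, dist (x N j) (x N k) ≤ 11 / 10 → ∀ l : Fin N, l ≠ k → (55 : ℝ) / 57 ≤ dist (x N k) (x N l)) ∧
        (Finset.univ.filter fun k : Fin N => k ≠ j ∧ dist (x N j) (x N k) ≤ 1).card = 12) with hSL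
  set SB := Finset.univ.filter fun j : Fin N => ¬ ((∀ k : Fin N, dist (x N j) (x N k) ≤ 11 / 10 →
      ∀ l : Fin N, l ≠ k → (55 : ℝ) / 57 ≤ dist (x N k) (x N l)) ∧
      (Finset.univ.filter fun k : Fin N => k ≠ j ∧ dist (x N j) (x N k) ≤ 1).card = 12) with hSB
  -- (a) not gapped-twelve ⇒ not locally twelve, or locally twelve with an annulus neighbour
  have hGT : (SGT.card : ℝ) ≤ SL.card + SA.card := by
    have hsub : SGT ⊆ SL ∪ SA := by
      intro i hi
      rw [hSGT, Finset.mem_filter] at hi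
      rw [Finset.mem_union, hSL, hSA, Finset.mem_filter, Finset.mem_filter]
      by_cases hL : ∀ j : Fin N, dist (x N i) (x N j) ≤ 7 / 2 →
          ((∀ k : Fin N, dist (x N j) (x N k) ≤ 11 / 10 → ∀ l : Fin N, l ≠ k → (55 : ℝ) / 57 ≤ dist (x N k) (x N l)) ∧
            (Finset.univ.filter fun k : Fin N => k ≠ j ∧ dist (x N j) (x N k) ≤ 1).card = 12)
      · right
        refine ⟨Finset.mem_univ _, hL, ?_⟩
        by_contra hAnn
        have hGi := hL i (by rw [dist_self]; norm_num)
        exact hi.2 (gappedTwelve_of_twelve (x N) hGi.1 hGi.2 hAnn)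
      · left
        exact ⟨Finset.mem_univ _, hL⟩
    exact_mod_cast (Finset.card_le_card hsub).trans (Finset.card_union_le _ _)
  -- (b) spoiled sites are few: packing count around the non-twelve sites
  have hLoc : (SL.card : ℝ) ≤ K * SB.card := by
    refine card_le_mul_card_of_local (x N)
      (fun j : Fin N => (∀ k : Fin N, dist (x N j) (x N k) ≤ 11 / 10 →
          ∀ l : Fin N, l ≠ k → (55 : ℝ) / 57 ≤ dist (x N k) (x N l)) ∧
        (Finset.univ.filter fun k : Fin N => k ≠ j ∧ dist (x N j) (x N k) ≤ 1).card = 12)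
      hδ₀ hsepN SL SB (fun i hi => ?_) (fun j hj => ?_)
    · rw [hSL, Finset.mem_filter] at hi
      exact hi.2
    · rw [hSB, Finset.mem_filter]
      exact ⟨Finset.mem_univ _, hj⟩
  -- (c) non-twelve sites are non-PRE sites (thick thirteen)
  have hGood : (SB.card : ℝ) ≤ SP.card := by
    have hsub : SB ⊆ SP := by
      intro j hj
      rw [hSB, Finset.mem_filter] at hj
      rw [hSP, Finset.mem_filter]
      refine ⟨Finset.mem_univ _, fun hp => hj.2 ⟨hp.1, ?_⟩⟩
      exact le_antisymm (card_bond_le_twelve hT (x N) hp.1) hp.2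
    exact_mod_cast Finset.card_le_card hsub
  have hKθ : K * (θ / (2 * K) * N) = θ / 2 * N := by
    field_simp
  calc (SGT.card : ℝ) ≤ SL.card + SA.card := hGT
    _ ≤ K * SB.card + θ / 2 * N := add_le_add hLoc hA
    _ ≤ K * SP.card + θ / 2 * N := by gcongr
    _ ≤ K * (θ / (2 * K) * N) + θ / 2 * N := by gcongr
    _ = θ * N := by rw [hKθ]; ring

end Summit.AtomisticToContinuum.Crystallization.Theorems

end
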